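import Summits.ResolutionOfSingularities.ResolutionOfSingularities.Theorems.FrobeniusLadderFInjectiveMacaulayficationRegularTowerInstanceE4
import Literature.AlgebraicGeometry.CossartJannsenSaito2020.BlowupTowerLocalize
import HarnessLib

/-!
# (RR-I′) THE GERM FLOORS: for EVERY blowing up `S′ → Spec 𝒪_{G,v}` along the vertex ideal `𝔪̃·𝒪_{G,v}` — the floors over which `RegTower.RegTowerTerminates` /
# `SingTowerConjecture` quantify — the `singCentre`-tower of `S′` has height EXACTLY one
# (crux `FInjectiveMacaulayfication` stmt-ResolutionOfSingularities-15315, chain w45a; res-L1-w45a-plan-1 R19.8a (3″) «germ-floor RR letters (RR-I′) on request»; over (RR-I)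
# `RegTower.InstanceE4` and the E4″ row p633422; seat res-L1-w45a-stub-1 g11)

[OURS · L1 W4.5a] Support file (`--supports stmt-ResolutionOfSingularities-15315 --as helper`); replaces the role of NO printed item; NOT a statement of any
manuscript; def-free; UNCONDITIONAL. AI-written (AI review is weaker than expert review).

`G = Spec k[X₀..X₄]/(X₀X₁ + X₂³ + X₃³ + X₄³)` (char 2), `v` the vertex, `𝔪 = (x̄)`, `X₁ = Bl_𝔪 G`, `P = X₁ ×_G Spec 𝒪_{G,v}` (the local model; `pr : P → X₁` a flat preimmersion).
* §1 `singCentre_pullback_eq_comap` — `singCentre p P = (vanishingIdeal ⟨(Reg X₁)ᶜ⟩).comap pr` (Temkin: `Reg P = pr⁻¹ Reg X₁`; CJS: reduced centres pull back to reduced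
  centres along flat preimmersions, `comap_vanishingIdeal_eq_of_flat_of_isPreimmersion`); `exists_not_mem_regularLocus_pullback` (a singular point of `P`: the singular point of
  `X₁` of (RR-I) lies over `v`, res-L1-w45a-lead-1's `π_eq_vertex_of_not_mem_regularLocus`).
* §2 ★★ `towerRegular_one_germFloor` — `TowerRegular singCentre p 1 S′` for every blowing up `g′ : S′ → Spec 𝒪_{G,v}` along `𝔪̃·𝒪_{G,v}` (`S′ ≅ P` by uniqueness; a blowing up of
  `P` along `𝓚_E·𝒪_P` is the base change of a blowing up of `X₁` along `𝓚_E`, regular by p633422, and regularity descends along the flat preimmersion);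
  ★ `not_towerRegular_zero_germFloor`, `towerHeight_germFloor` (height EXACTLY one) — i.e. for THIS germ and THIS first floor the conclusion `∃ n, TowerRegular singCentre p n S′`
  of `RegTowerTerminates singCentre` holds with `n = 1` (the binders' side conditions — FULL, regular off the fibre — are not used). ONE instance; evidence for nothing beyond itself.
[folklore assembly; cite: GortzWedhorn2020, Prop. 13.91 (2); Temkin2008, Prop. 2.3.4 (proof); CossartJannsenSaito2020, p. 107]
-/

-- single-problem summit: the doubled namespace component is forced
set_option linter.dupNamespace false

noncomputable section

namespace Summit.ResolutionOfSingularities.ResolutionOfSingularities.Theorems.FInjectiveMacaulayfication.RegTower.InstanceE4Germ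

open MvPolynomial Literature.AlgebraicGeometry.Resolution AlgebraicGeometry CategoryTheory CategoryTheory.Limits TopologicalSpace
open Summit.ResolutionOfSingularities.ResolutionOfSingularities.Theorems.FInjectiveMacaulayfication
open Summit.ResolutionOfSingularities.ResolutionOfSingularities.Theorems.FInjectiveMacaulayfication.RegTower

/-! ## §1 The local model `P = X₁ ×_G Spec 𝒪_{G,v}` -/

/-- **`singCentre p (X′ ×_X Spec 𝒪_{X,x}) = (vanishingIdeal ⟨(Reg X′)ᶜ⟩)·𝒪`** for any `π : X′ → X` with closed singular locus: the singular locus of the local model is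
the preimage of that of `X′` (Temkin), and reduced centres pull back to reduced centres along flat preimmersions (CJS / GW 13.91 (2)). [cite: Temkin2008, Prop. 2.3.4 (proof)]
[cite: GortzWedhorn2020, Prop. 13.91 (2)] -/
theorem singCentre_pullback_eq_comap {X X' : Scheme.{0}} (π : X' ⟶ X) (x : X) (hcl : IsClosed ((Scheme.regularLocus X')ᶜ)) (p : ℕ) :
    singCentre p (pullback π (X.fromSpecStalk x)) =
      (Scheme.IdealSheafData.vanishingIdeal ⟨(Scheme.regularLocus X')ᶜ, hcl⟩).comap (pullback.fst π (X.fromSpecStalk x)) := by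
  haveI := flat_fromSpecStalk X x
  rw [Literature.AlgebraicGeometry.CossartJannsenSaito2020.comap_vanishingIdeal_eq_of_flat_of_isPreimmersion]
  change Scheme.IdealSheafData.vanishingIdeal _ = _
  congr 1
  ext1
  change closure ((Scheme.regularLocus (pullback π (X.fromSpecStalk x)))ᶜ) = (pullback.fst π (X.fromSpecStalk x)).base ⁻¹' (Scheme.regularLocus X')ᶜ
  have hpre : (Scheme.regularLocus (pullback π (X.fromSpecStalk x)))ᶜ = (pullback.fst π (X.fromSpecStalk x)).base ⁻¹' (Scheme.regularLocus X')ᶜ := by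
    ext s
    rw [Set.mem_compl_iff, mem_regularLocus_iff_pullback_fst_fromSpecStalk, Set.mem_preimage, Set.mem_compl_iff]
  rw [hpre]
  exact (hcl.preimage (pullback.fst π (X.fromSpecStalk x)).continuous).closure_eq

/-- **The local model `X₁ ×_G Spec 𝒪_{G,v}` of `Bl_𝔪 G` has a singular point**: the singular point of `X₁` of (RR-I) lies over `v` (res-L1-w45a-lead-1's
`E4GermSingularCentre.π_eq_vertex_of_not_mem_regularLocus`), hence in the image of the local model. [folklore] -/
theorem exists_not_mem_regularLocus_pullback (k : Type) [Field k] [CharP k 2] (f : MvPolynomial (Fin 5) k)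
    (hf : f = X 0 * X 1 + X 2 ^ 3 + X 3 ^ 3 + X 4 ^ 3)
    (v : Spec (.of (MvPolynomial (Fin 5) k ⧸ Ideal.span {f})))
    (hv : v.asIdeal = Ideal.span (Set.range fun j : Fin 5 => Ideal.Quotient.mk (Ideal.span {f}) (X j)))
    (𝔪 : Ideal (MvPolynomial (Fin 5) k ⧸ Ideal.span {f})) (h𝔪 : 𝔪 = Ideal.span (Set.range fun j : Fin 5 => Ideal.Quotient.mk (Ideal.span {f}) (X j))) :
    ∃ s : ↑(pullback (affineBlowup.π 𝔪) ((Spec (.of (MvPolynomial (Fin 5) k ⧸ Ideal.span {f}))).fromSpecStalk v)),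
      s ∉ Scheme.regularLocus (pullback (affineBlowup.π 𝔪) ((Spec (.of (MvPolynomial (Fin 5) k ⧸ Ideal.span {f}))).fromSpecStalk v)) := by
  obtain ⟨x₁, hx₁⟩ := InstanceE4.exists_not_mem_regularLocus_affineBlowup k f hf 𝔪 h𝔪
  have hover : (affineBlowup.π 𝔪).base x₁ = v := E4GermSingularCentre.π_eq_vertex_of_not_mem_regularLocus k f hf v hv 𝔪 h𝔪 x₁ hx₁
  have hmem : x₁ ∈ Set.range (pullback.fst (affineBlowup.π 𝔪) ((Spec (.of (MvPolynomial (Fin 5) k ⧸ Ideal.span {f}))).fromSpecStalk v)) := by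
    rw [range_pullback_fst_fromSpecStalk]
    change (affineBlowup.π 𝔪).base x₁ ⤳ v
    rw [hover]
  obtain ⟨s, hs⟩ := hmem
  exact ⟨s, fun h => hx₁ (hs ▸ (mem_regularLocus_iff_pullback_fst_fromSpecStalk (affineBlowup.π 𝔪) v s).mp h)⟩

/-! ## §2 The germ floors have `singCentre`-tower height exactly one -/

/-- ★★ **Every blowing up `S′ → Spec 𝒪_{G,v}` along `𝔪̃·𝒪_{G,v}` has `TowerRegular singCentre p 1 S′`**: `S′ ≅ P = X₁ ×_G Spec 𝒪_{G,v}` (flat base change of `Bl_𝔪 G`,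
uniqueness); `singCentre p S′` transports to `singCentre p P = 𝓚_E·𝒪_P` (§1); a blowing up of `P` along `𝓚_E·𝒪_P` is (isomorphic to) the base change of a blowing up of `X₁`
along `𝓚_E`, which is regular (`E4FloorTwoGlue.isRegular_of_isBlowup_vanishingIdeal`, p633422), and regularity descends along the flat preimmersion. Stated at EVERY point `v`
of `G` (at `v ≠` the vertex the pulled-back centre is the unit ideal and everything is an isomorphism). [OURS · instance]
[cite: GortzWedhorn2020, Prop. 13.91 (2); Temkin2008, Prop. 2.3.4 (proof)] -/
theorem towerRegular_one_germFloor (k : Type) [Field k] [CharP k 2] (f : MvPolynomial (Fin 5) k)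
    (hf : f = X 0 * X 1 + X 2 ^ 3 + X 3 ^ 3 + X 4 ^ 3)
    (v : Spec (.of (MvPolynomial (Fin 5) k ⧸ Ideal.span {f})))
    (𝔪 : Ideal (MvPolynomial (Fin 5) k ⧸ Ideal.span {f})) (h𝔪 : 𝔪 = Ideal.span (Set.range fun j : Fin 5 => Ideal.Quotient.mk (Ideal.span {f}) (X j))) (p : ℕ)
    (S' : Scheme.{0}) (g' : S' ⟶ Spec ((Spec (.of (MvPolynomial (Fin 5) k ⧸ Ideal.span {f}))).presheaf.stalk v))
    (hg' : IsBlowup g' ((affineBlowup.idealSheaf 𝔪).comap ((Spec (.of (MvPolynomial (Fin 5) k ⧸ Ideal.span {f}))).fromSpecStalk v))) :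
    TowerRegular singCentre p 1 S' := by
  haveI := flat_fromSpecStalk (Spec (.of (MvPolynomial (Fin 5) k ⧸ Ideal.span {f}))) v
  -- the local model and `S′ ≅ P`
  have hP : IsBlowup (pullback.snd (affineBlowup.π 𝔪) ((Spec (.of (MvPolynomial (Fin 5) k ⧸ Ideal.span {f}))).fromSpecStalk v))
      ((affineBlowup.idealSheaf 𝔪).comap ((Spec (.of (MvPolynomial (Fin 5) k ⧸ Ideal.span {f}))).fromSpecStalk v)) :=
    (affineBlowup.isBlowup 𝔪).pullback_snd_of_flat _
  obtain ⟨e, -, -⟩ := hg'.unique hP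
  have hcl := E4GermSingularCentre.isClosed_compl_regularLocus k f 𝔪
  intro S₂ g₂ hg₂
  -- `g₂ ≫ e.hom : S₂ → P` is a blowing up along `singCentre p P = 𝓚_E·𝒪_P`
  have h2 := hg₂.comp_iso e
  rw [show e.inv = e.symm.hom from rfl, InstanceE4.comap_singCentre_of_iso p e.symm, singCentre_pullback_eq_comap (affineBlowup.π 𝔪) v hcl p] at h2
  -- a blowing up of `X₁` along `𝓚_E` and its base change to `P`
  obtain ⟨X₂, π₂, hπ₂⟩ := exists_isBlowup (affineBlowup 𝔪)
    (Scheme.IdealSheafData.vanishingIdeal ⟨(Scheme.regularLocus (affineBlowup 𝔪))ᶜ, hcl⟩)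
  have hreg := E4FloorTwoGlue.isRegular_of_isBlowup_vanishingIdeal k f hf 𝔪 h𝔪 ⟨(Scheme.regularLocus (affineBlowup 𝔪))ᶜ, hcl⟩ rfl π₂ hπ₂
  have hbc : IsBlowup (pullback.snd π₂ (pullback.fst (affineBlowup.π 𝔪) ((Spec (.of (MvPolynomial (Fin 5) k ⧸ Ideal.span {f}))).fromSpecStalk v)))
      ((Scheme.IdealSheafData.vanishingIdeal ⟨(Scheme.regularLocus (affineBlowup 𝔪))ᶜ, hcl⟩).comap
        (pullback.fst (affineBlowup.π 𝔪) ((Spec (.of (MvPolynomial (Fin 5) k ⧸ Ideal.span {f}))).fromSpecStalk v))) :=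
    hπ₂.pullback_snd_of_flat _
  obtain ⟨e₂, -, -⟩ := h2.unique hbc
  -- regularity descends along the flat preimmersion `S₂ ≅ X₂ ×_{X₁} P → X₂`
  intro s
  rw [mem_regularLocus_iff_of_flat_of_isPreimmersion e₂.hom s,
    mem_regularLocus_iff_of_flat_of_isPreimmersion (pullback.fst π₂ (pullback.fst (affineBlowup.π 𝔪) _))]
  exact (Scheme.mem_regularLocus _).mpr (hreg _)

/-- ★ **No such `S′` is regular** (`S′ ≅ P` has a singular point, §1). [OURS · instance] -/
theorem not_towerRegular_zero_germFloor (k : Type) [Field k] [CharP k 2] (f : MvPolynomial (Fin 5) k)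
    (hf : f = X 0 * X 1 + X 2 ^ 3 + X 3 ^ 3 + X 4 ^ 3)
    (v : Spec (.of (MvPolynomial (Fin 5) k ⧸ Ideal.span {f})))
    (hv : v.asIdeal = Ideal.span (Set.range fun j : Fin 5 => Ideal.Quotient.mk (Ideal.span {f}) (X j)))
    (𝔪 : Ideal (MvPolynomial (Fin 5) k ⧸ Ideal.span {f})) (h𝔪 : 𝔪 = Ideal.span (Set.range fun j : Fin 5 => Ideal.Quotient.mk (Ideal.span {f}) (X j))) (p : ℕ)
    (S' : Scheme.{0}) (g' : S' ⟶ Spec ((Spec (.of (MvPolynomial (Fin 5) k ⧸ Ideal.span {f}))).presheaf.stalk v))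
    (hg' : IsBlowup g' ((affineBlowup.idealSheaf 𝔪).comap ((Spec (.of (MvPolynomial (Fin 5) k ⧸ Ideal.span {f}))).fromSpecStalk v))) :
    ¬ TowerRegular singCentre p 0 S' := by
  haveI := flat_fromSpecStalk (Spec (.of (MvPolynomial (Fin 5) k ⧸ Ideal.span {f}))) v
  have hP : IsBlowup (pullback.snd (affineBlowup.π 𝔪) ((Spec (.of (MvPolynomial (Fin 5) k ⧸ Ideal.span {f}))).fromSpecStalk v))
      ((affineBlowup.idealSheaf 𝔪).comap ((Spec (.of (MvPolynomial (Fin 5) k ⧸ Ideal.span {f}))).fromSpecStalk v)) :=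
    (affineBlowup.isBlowup 𝔪).pullback_snd_of_flat _
  obtain ⟨e, -, -⟩ := hg'.unique hP
  intro h
  obtain ⟨s, hs⟩ := exists_not_mem_regularLocus_pullback k f hf v hv 𝔪 h𝔪
  exact hs (InstanceE4.towerRegular_zero_of_iso e.symm h s)

/-- **Height EXACTLY one for every germ floor**: the conclusion `∃ n, TowerRegular singCentre p n S′` of `RegTowerTerminates singCentre` holds at this germ and this first floor
with `n = 1` and not with `n = 0`. [OURS · one instance] -/
theorem towerHeight_germFloor (k : Type) [Field k] [CharP k 2] (f : MvPolynomial (Fin 5) k)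
    (hf : f = X 0 * X 1 + X 2 ^ 3 + X 3 ^ 3 + X 4 ^ 3)
    (v : Spec (.of (MvPolynomial (Fin 5) k ⧸ Ideal.span {f})))
    (hv : v.asIdeal = Ideal.span (Set.range fun j : Fin 5 => Ideal.Quotient.mk (Ideal.span {f}) (X j)))
    (𝔪 : Ideal (MvPolynomial (Fin 5) k ⧸ Ideal.span {f})) (h𝔪 : 𝔪 = Ideal.span (Set.range fun j : Fin 5 => Ideal.Quotient.mk (Ideal.span {f}) (X j))) (p : ℕ)
    (S' : Scheme.{0}) (g' : S' ⟶ Spec ((Spec (.of (MvPolynomial (Fin 5) k ⧸ Ideal.span {f}))).presheaf.stalk v))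
    (hg' : IsBlowup g' ((affineBlowup.idealSheaf 𝔪).comap ((Spec (.of (MvPolynomial (Fin 5) k ⧸ Ideal.span {f}))).fromSpecStalk v))) :
    (∃ n, TowerRegular singCentre p n S') ∧ TowerRegular singCentre p 1 S' ∧ ¬ TowerRegular singCentre p 0 S' :=
  ⟨⟨1, towerRegular_one_germFloor k f hf v 𝔪 h𝔪 p S' g' hg'⟩, towerRegular_one_germFloor k f hf v 𝔪 h𝔪 p S' g' hg',
    not_towerRegular_zero_germFloor k f hf v hv 𝔪 h𝔪 p S' g' hg'⟩

end Summit.ResolutionOfSingularities.ResolutionOfSingularities.Theorems.FInjectiveMacaulayfication.RegTower.InstanceE4Germ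

end
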